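import Literature.Probability.Percolation.ConditionalPositiveAssociationProofs
import Literature.Probability.Percolation.TwoClusterConditionalAssociation
import Summits.CriticalPhenomena.PercolationContinuityZ3.Theorems.PercNearOneGluingAdditiveGluingSandwichPrelim
import HarnessLib

/-!
# The functionals of the two-source inequality (A2) behind the conditioned covariance transfer COV(τ)
# — finite-sum framework

Context.  The conditioned covariance transfer COV(τ) — for an increasing functional `Ψ` of the open cluster
`C_x` of an "owner" `x`, an "avoided" vertex `y` and two observers `o, v`,
`Cov(Ψ(C_x), 1{o∈C_x} | x↮y) ≥ μ(o↔v | v↮x, v↮y)·Cov(Ψ(C_x), 1{v∈C_x} | x↮y)` — yields the surplus transfer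
(S5)₂, (GEN) for three relays and Kozma–Nitzan's Conjecture 1 for `|A| = 3` through
`SurplusTransfer.surplusTransfer_pair_of_covTransfer` / `gen_triple_of_covTransfer` /
`kn_conj1_three_of_plusTransfer`.  The proof runs a van den Berg–Häggström–Kahn-type induction on the vertex set for a TWO-SOURCE inequality
  (A2)  `E(N)·Y(N') ≤ M(N ∪ N')·X(N ∩ N')`
between four functionals of "source sets" `N, N'` of vertices, exactly in the style of this library's proof of
[VandenbergHaggstromKahn2005, Thm. 1.1] (`BHK2006.core`, file `ConditionalPositiveAssociationProofs.lean`: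
percolation restricted to a vertex set `U`, clusters `rC U s ω`, avoidance events `rD U s X`, the random
neighbour set `rS U Z ω`, the star decomposition `step_sum`, Ahlswede–Daykin).

THIS FILE sets up the functionals in that finite-sum framework (`μ` = the product weight `BHK2006.weight w` on
`Set (Sym2 V)`, percolation restricted to `U : Finset V` through `ω ∩ edgesIn U`) and records their elementary
properties; the induction itself is in the companion files.  For `U : Finset V`, owner `x`, observers `o, v`,
an increasing nonnegative `Ψ : Set V → ℝ` and a source set `N : Set V`:
* `CovTau.sC U N ω` — the vertex cluster of the SET `N` in `G[U]`; `CovTau.rest U N ω = U ∖ sC U N ω`;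
* `CovTau.Ef w U x o v N = μ(o ↔ v, v ↮ x, v ↮ N)` (all in `G[U]`);  `CovTau.Mf w U x v N = μ(v ↮ x, v ↮ N)`;
* `CovTau.tf w U x Ψ = E Ψ(C_x)`, `CovTau.cf w U x v = μ(x ↔ v)`, `CovTau.Bf w U x v Ψ = Cov(Ψ(C_x), 1{v ∈ C_x})`
  (`≥ 0`, Harris), `CovTau.qf w U x o v = μ(o ↔ v | v ↮ x)` (`Ef ∅ / Mf ∅`);
* `CovTau.Yf w U x v Ψ N = E[ B_{G[U ∖ C_N]} ; x ∉ C_N ]` and `CovTau.Xf w U x o v Ψ N = E[ q_{G[U∖C_N]}·B_{G[U∖C_N]} ; x ∉ C_N ]`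
  — the functionals `Y`, `X` (`B(W) := Cov_{G∖W}`, `q(W) := μ_{G∖W}(o↔v | v↮x)`).
Lemmas: nonnegativity, `Ef ≤ Mf`, antitonicity of `Ef`, `Mf` in the source set, the vanishing cases
(`v ∈ N` or `v = x` ⇒ `Ef = 0`; `x ∈ N` ⇒ `Yf = Xf = 0`; `x ∉ U` or `v ∉ U` or `v = x` ⇒ `Bf = 0`), and `N ⊆ sC U N ω`,
`x ∉ sC U N ω ↔ ω ∈ rD U x N`.
[cite: VandenbergHaggstromKahn2005, Thm. 1.1 (pp. 3–5)] [cite: KozmaNitzan2024, Conj. 1 (p. 3)]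
-/

noncomputable section

namespace Summit.CriticalPhenomena.PercolationContinuityZ3.Theorems.CovTau

open Literature.Probability.Percolation
open Literature.Probability.Percolation.BHK2006
open Literature.Probability.Percolation.DecisionTree (ind ind_of_mem ind_of_not_mem ind_nonneg)
open scoped Classical

variable {V : Type*}

/-! ### Set clusters in `G[U]` -/

/-- The vertex cluster `C_N` of the source SET `N` in the percolation restricted to `U`: the vertices joined to
some `z ∈ N` by an open path inside `U` (every `z ∈ N` belongs to it).
[cite: VandenbergHaggstromKahn2005, §1 p. 3 (clusters of the restricted model)] -/
def sC (U : Finset V) (N : Set V) (ω : Set (Sym2 V)) : Set V :=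
  {u | ∃ z ∈ N, (openGraph (ω ∩ edgesIn U)).Reachable z u}

/-- The vertex set `U ∖ C_N` of the "world" left after deleting the cluster of `N` (a `Finset`).
[cite: VandenbergHaggstromKahn2005, §1 p. 4 (the induced model on `G` minus a vertex set)] -/
def rest (U : Finset V) (N : Set V) (ω : Set (Sym2 V)) : Finset V := U.filter fun u => u ∉ sC U N ω

/-- `1{o ∈ C_v}` as a (monotone) function of the open EDGE cluster of `v`. [folklore] -/
def oInd (o v : V) (C : Set (Sym2 V)) : ℝ := ind {C : Set (Sym2 V) | o = v ∨ ∃ e ∈ C, o ∈ e} C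

/-- Unfolding of membership in the set cluster. [folklore] -/
theorem mem_sC {U : Finset V} {N : Set V} {ω : Set (Sym2 V)} {u : V} :
    u ∈ sC U N ω ↔ ∃ z ∈ N, (openGraph (ω ∩ edgesIn U)).Reachable z u := Iff.rfl

/-- Every source vertex lies in the set cluster. [folklore] -/
theorem subset_sC (U : Finset V) (N : Set V) (ω : Set (Sym2 V)) : N ⊆ sC U N ω :=
  fun z hz => ⟨z, hz, SimpleGraph.Reachable.refl z⟩

/-- The set cluster is monotone in the source set. [folklore] -/
theorem sC_mono_set (U : Finset V) {N N' : Set V} (h : N ⊆ N') (ω : Set (Sym2 V)) : sC U N ω ⊆ sC U N' ω :=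
  fun _ ⟨z, hz, hr⟩ => ⟨z, h hz, hr⟩

/-- The set cluster is monotone in the configuration. [folklore] -/
theorem sC_mono (U : Finset V) (N : Set V) {ω ω' : Set (Sym2 V)} (h : ω ⊆ ω') : sC U N ω ⊆ sC U N ω' :=
  fun _ ⟨z, hz, hr⟩ => ⟨z, hz, hr.mono (openGraph_le (Set.inter_subset_inter_left _ h))⟩

/-- The cluster of the empty source set is empty. [folklore] -/
theorem sC_empty (U : Finset V) (ω : Set (Sym2 V)) : sC U (∅ : Set V) ω = ∅ :=
  Set.eq_empty_of_forall_notMem fun _ ⟨_, hz, _⟩ => hz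

/-- `rest U ∅ ω = U`. [folklore] -/
theorem rest_empty (U : Finset V) (ω : Set (Sym2 V)) : rest U (∅ : Set V) ω = U := by
  simp [rest, sC_empty]

/-- `rest U N ω ⊆ U`. [folklore] -/
theorem rest_subset (U : Finset V) (N : Set V) (ω : Set (Sym2 V)) : rest U N ω ⊆ U := Finset.filter_subset _ _

/-- Membership in `rest`. [folklore] -/
theorem mem_rest {U : Finset V} {N : Set V} {ω : Set (Sym2 V)} {u : V} :
    u ∈ rest U N ω ↔ u ∈ U ∧ u ∉ sC U N ω := Finset.mem_filter

/-- `x ∉ C_N` iff `x ↮ N` (the avoidance event `rD U x N`). [folklore] -/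
theorem not_mem_sC_iff (U : Finset V) (N : Set V) (ω : Set (Sym2 V)) (x : V) :
    x ∉ sC U N ω ↔ ω ∈ rD U x N := by
  simp only [mem_sC, not_exists, not_and, rD, Set.mem_setOf_eq]
  exact ⟨fun h z hz hr => h z hz hr.symm, fun h z hz hr => h z hz hr.symm⟩

/-- The singleton cluster `sC U {x}` is the vertex cluster of `x`. [folklore] -/
theorem mem_sC_singleton {U : Finset V} {ω : Set (Sym2 V)} {x u : V} :
    u ∈ sC U ({x} : Set V) ω ↔ (openGraph (ω ∩ edgesIn U)).Reachable x u := by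
  simp [mem_sC]

/-- `oInd` is an indicator: nonnegative. [folklore] -/
theorem oInd_nonneg (o v : V) (C : Set (Sym2 V)) : 0 ≤ oInd o v C := ind_nonneg _ _

/-- `oInd ≤ 1`. [folklore] -/
theorem oInd_le_one (o v : V) (C : Set (Sym2 V)) : oInd o v C ≤ 1 := ind_le_one _ _

/-- `oInd o v` is monotone in the edge set. [folklore] -/
theorem oInd_mono (o v : V) : Monotone (oInd o v) := by
  intro C C' h
  by_cases hC : C ∈ {C : Set (Sym2 V) | o = v ∨ ∃ e ∈ C, o ∈ e}
  · have hC' : C' ∈ {C : Set (Sym2 V) | o = v ∨ ∃ e ∈ C, o ∈ e} := by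
      rcases hC with h1 | ⟨e, he, hoe⟩
      · exact Or.inl h1
      · exact Or.inr ⟨e, h he, hoe⟩
    simp only [oInd, ind_of_mem hC, ind_of_mem hC', le_refl]
  · simp only [oInd, ind_of_not_mem hC]; exact ind_nonneg _ _

/-- `oInd o v (rC U v ω) = 1{v ↔ o in G[U]}`. [folklore] -/
theorem oInd_rC (U : Finset V) (o v : V) (ω : Set (Sym2 V)) :
    oInd o v (rC U v ω) = ind {ω : Set (Sym2 V) | (openGraph (ω ∩ edgesIn U)).Reachable v o} ω := by
  unfold oInd
  by_cases hr : (openGraph (ω ∩ edgesIn U)).Reachable v o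
  · have h1 : ω ∈ {ω : Set (Sym2 V) | (openGraph (ω ∩ edgesIn U)).Reachable v o} := hr
    have h2 : rC U v ω ∈ {C : Set (Sym2 V) | o = v ∨ ∃ e ∈ C, o ∈ e} :=
      (reachable_iff_exists_mem_openEdgeCluster _ v o).1 hr
    rw [ind_of_mem h1, ind_of_mem h2]
  · have h1 : ω ∉ {ω : Set (Sym2 V) | (openGraph (ω ∩ edgesIn U)).Reachable v o} := hr
    have h2 : rC U v ω ∉ {C : Set (Sym2 V) | o = v ∨ ∃ e ∈ C, o ∈ e} := fun h =>
      hr ((reachable_iff_exists_mem_openEdgeCluster _ v o).2 h)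
    rw [ind_of_not_mem h1, ind_of_not_mem h2]

variable [Fintype V]

/-! ### The functionals -/

/-- `E(N) = μ_{G[U]}(o ↔ v, v ↮ x, v ↮ N)`. [cite: VandenbergHaggstromKahn2005, §1 p. 3] -/
def Ef (w : Sym2 V → ℝ) (U : Finset V) (x o v : V) (N : Set V) : ℝ :=
  ∑ ω, weight w ω * (oInd o v (rC U v ω) * ind (rD U v (insert x N)) ω)

/-- `M(N) = μ_{G[U]}(v ↮ x, v ↮ N)`. [cite: VandenbergHaggstromKahn2005, §1 p. 3] -/
def Mf (w : Sym2 V → ℝ) (U : Finset V) (x v : V) (N : Set V) : ℝ :=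
  ∑ ω, weight w ω * ind (rD U v (insert x N)) ω

/-- `t = E_{G[U]} Ψ(C_x)`. [folklore] -/
def tf (w : Sym2 V → ℝ) (U : Finset V) (x : V) (Ψ : Set V → ℝ) : ℝ :=
  ∑ ω, weight w ω * Ψ (sC U ({x} : Set V) ω)

/-- `c = μ_{G[U]}(x ↔ v)`. [folklore] -/
def cf (w : Sym2 V → ℝ) (U : Finset V) (x v : V) : ℝ :=
  ∑ ω, weight w ω * ind {ω : Set (Sym2 V) | (openGraph (ω ∩ edgesIn U)).Reachable x v} ω

/-- `B = Cov_{G[U]}(Ψ(C_x), 1{v ∈ C_x})`.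
[cite: VandenbergHaggstromKahn2005, §1 p. 6 (Harris' inequality)] -/
def Bf (w : Sym2 V → ℝ) (U : Finset V) (x v : V) (Ψ : Set V → ℝ) : ℝ :=
  (∑ ω, weight w ω * (Ψ (sC U ({x} : Set V) ω) *
      ind {ω : Set (Sym2 V) | (openGraph (ω ∩ edgesIn U)).Reachable x v} ω)) - tf w U x Ψ * cf w U x v

/-- `q = μ_{G[U]}(o ↔ v | v ↮ x) = E(∅)/M(∅)`. [folklore] -/
def qf (w : Sym2 V → ℝ) (U : Finset V) (x o v : V) : ℝ := Ef w U x o v ∅ / Mf w U x v ∅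

/-- `Y(N) = E[ B(C_N) ; x ∉ C_N ]` with `B(W)` the covariance in the world `G[U ∖ W]`.
[cite: VandenbergHaggstromKahn2005, §1 p. 4] -/
def Yf (w : Sym2 V → ℝ) (U : Finset V) (x v : V) (Ψ : Set V → ℝ) (N : Set V) : ℝ :=
  ∑ ω, weight w ω * (Bf w (rest U N ω) x v Ψ * ind (rD U x N) ω)

/-- `X(N) = E[ q(C_N)·B(C_N) ; x ∉ C_N ]`. [cite: VandenbergHaggstromKahn2005, §1 p. 4] -/
def Xf (w : Sym2 V → ℝ) (U : Finset V) (x o v : V) (Ψ : Set V → ℝ) (N : Set V) : ℝ :=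
  ∑ ω, weight w ω * (qf w (rest U N ω) x o v * Bf w (rest U N ω) x v Ψ * ind (rD U x N) ω)

/-! ### Elementary properties -/

section Props

variable {w : Sym2 V → ℝ} (hw0 : ∀ e, 0 ≤ w e) (hw1 : ∀ e, w e ≤ 1)
include hw0 hw1

/-- `E(N) ≥ 0`. [folklore] -/
theorem Ef_nonneg (U : Finset V) (x o v : V) (N : Set V) : 0 ≤ Ef w U x o v N :=
  sum_ind_nonneg hw0 hw1 (fun _ => oInd_nonneg _ _ _) _

/-- `M(N) ≥ 0`. [folklore] -/
theorem Mf_nonneg (U : Finset V) (x v : V) (N : Set V) : 0 ≤ Mf w U x v N :=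
  Finset.sum_nonneg fun ω _ => mul_nonneg (weight_nonneg hw0 hw1 ω) (ind_nonneg _ _)

/-- `E(N) ≤ M(N)`. [folklore] -/
theorem Ef_le_Mf (U : Finset V) (x o v : V) (N : Set V) : Ef w U x o v N ≤ Mf w U x v N :=
  Finset.sum_le_sum fun ω _ => mul_le_mul_of_nonneg_left
    (by simpa only [one_mul] using
      mul_le_mul_of_nonneg_right (oInd_le_one o v (rC U v ω)) (ind_nonneg (rD U v (insert x N)) ω))
    (weight_nonneg hw0 hw1 ω)

/-- `E` is antitone in the source set. [cite: VandenbergHaggstromKahn2005, §1 p. 3] -/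
theorem Ef_antitone (U : Finset V) (x o v : V) {N N' : Set V} (h : N ⊆ N') :
    Ef w U x o v N' ≤ Ef w U x o v N :=
  sum_ind_mono hw0 hw1 (fun _ => oInd_nonneg _ _ _) (rD_antitone (Set.insert_subset_insert h))

/-- `M` is antitone in the source set. [cite: VandenbergHaggstromKahn2005, §1 p. 3] -/
theorem Mf_antitone (U : Finset V) (x v : V) {N N' : Set V} (h : N ⊆ N') :
    Mf w U x v N' ≤ Mf w U x v N := by
  have := sum_ind_mono hw0 hw1 (h := fun _ => (1 : ℝ)) (fun _ => zero_le_one)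
    (rD_antitone (U := U) (s := v) (Set.insert_subset_insert (a := x) h)) (w := w)
  simpa only [Mf, one_mul] using this

/-- `q ≥ 0`. [folklore] -/
theorem qf_nonneg (U : Finset V) (x o v : V) : 0 ≤ qf w U x o v :=
  div_nonneg (Ef_nonneg hw0 hw1 U x o v ∅) (Mf_nonneg hw0 hw1 U x v ∅)

/-- `q ≤ 1`. [folklore] -/
theorem qf_le_one (U : Finset V) (x o v : V) : qf w U x o v ≤ 1 :=
  div_le_one_of_le₀ (Ef_le_Mf hw0 hw1 U x o v ∅) (Mf_nonneg hw0 hw1 U x v ∅)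

/-- **`B ≥ 0` (Harris)**: `Ψ(C_x)` and `1{v ∈ C_x}` are increasing, so positively correlated under the product
weight (normalised: `Σ weight = 1`). [cite: VandenbergHaggstromKahn2005, §1 p. 6 (Harris' inequality)] -/
theorem Bf_nonneg (hm : ∑ ω, weight w ω = 1) (U : Finset V) (x v : V) {Ψ : Set V → ℝ}
    (hΨ : ∀ S T : Set V, S ⊆ T → Ψ S ≤ Ψ T) (hΨ0 : ∀ S, 0 ≤ Ψ S) : 0 ≤ Bf w U x v Ψ := by
  have h := harris hw0 hw1 (f := fun ω => Ψ (sC U ({x} : Set V) ω))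
    (g := ind {ω : Set (Sym2 V) | (openGraph (ω ∩ edgesIn U)).Reachable x v})
    (fun _ => hΨ0 _) (fun _ => ind_nonneg _ _) (fun a b hab => hΨ _ _ (sC_mono U _ hab))
    (by
      intro a b hab
      by_cases ha : a ∈ {ω : Set (Sym2 V) | (openGraph (ω ∩ edgesIn U)).Reachable x v}
      · have hb : b ∈ {ω : Set (Sym2 V) | (openGraph (ω ∩ edgesIn U)).Reachable x v} :=
          Set.mem_setOf.2 ((Set.mem_setOf.1 ha).mono (openGraph_le (Set.inter_subset_inter_left _ hab)))
        rw [ind_of_mem ha, ind_of_mem hb]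
      · rw [ind_of_not_mem ha]; exact ind_nonneg _ _)
  rw [hm, one_mul] at h
  unfold Bf tf cf
  linarith

/-- `Y(N) ≥ 0`. [folklore] -/
theorem Yf_nonneg (hm : ∑ ω, weight w ω = 1) (U : Finset V) (x v : V) {Ψ : Set V → ℝ}
    (hΨ : ∀ S T : Set V, S ⊆ T → Ψ S ≤ Ψ T) (hΨ0 : ∀ S, 0 ≤ Ψ S) (N : Set V) : 0 ≤ Yf w U x v Ψ N :=
  sum_ind_nonneg hw0 hw1 (fun _ => Bf_nonneg hw0 hw1 hm _ x v hΨ hΨ0) _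

/-- `X(N) ≥ 0`. [folklore] -/
theorem Xf_nonneg (hm : ∑ ω, weight w ω = 1) (U : Finset V) (x o v : V) {Ψ : Set V → ℝ}
    (hΨ : ∀ S T : Set V, S ⊆ T → Ψ S ≤ Ψ T) (hΨ0 : ∀ S, 0 ≤ Ψ S) (N : Set V) : 0 ≤ Xf w U x o v Ψ N :=
  sum_ind_nonneg hw0 hw1 (fun _ => mul_nonneg (qf_nonneg hw0 hw1 _ x o v) (Bf_nonneg hw0 hw1 hm _ x v hΨ hΨ0)) _

end Props

/-! ### Vanishing cases -/

/-- `E(N) = 0` when `v ∈ {x} ∪ N` (`v ↮ v` is impossible). [folklore] -/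
theorem Ef_eq_zero_of_mem (w : Sym2 V → ℝ) (U : Finset V) (x o v : V) {N : Set V} (hv : v ∈ insert x N) :
    Ef w U x o v N = 0 :=
  Finset.sum_eq_zero fun ω _ => by
    rw [rD_eq_empty hv, ind_of_not_mem (Set.notMem_empty ω)]; ring

/-- `M(N) = 0` when `v ∈ {x} ∪ N`. [folklore] -/
theorem Mf_eq_zero_of_mem (w : Sym2 V → ℝ) (U : Finset V) (x v : V) {N : Set V} (hv : v ∈ insert x N) :
    Mf w U x v N = 0 :=
  Finset.sum_eq_zero fun ω _ => by
    rw [rD_eq_empty hv, ind_of_not_mem (Set.notMem_empty ω)]; ring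

/-- `Y(N) = 0` when `x ∈ N` (`x ∈ C_N` always). [folklore] -/
theorem Yf_eq_zero_of_mem (w : Sym2 V → ℝ) (U : Finset V) (x v : V) (Ψ : Set V → ℝ) {N : Set V}
    (hx : x ∈ N) : Yf w U x v Ψ N = 0 :=
  Finset.sum_eq_zero fun ω _ => by
    rw [rD_eq_empty hx, ind_of_not_mem (Set.notMem_empty ω)]; ring

/-- `X(N) = 0` when `x ∈ N`. [folklore] -/
theorem Xf_eq_zero_of_mem (w : Sym2 V → ℝ) (U : Finset V) (x o v : V) (Ψ : Set V → ℝ) {N : Set V}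
    (hx : x ∈ N) : Xf w U x o v Ψ N = 0 :=
  Finset.sum_eq_zero fun ω _ => by
    rw [rD_eq_empty hx, ind_of_not_mem (Set.notMem_empty ω)]; ring

/-- In a world not containing `v` (with `v ≠ x`) the covariance `B` vanishes: `C_x` cannot contain `v`.
[folklore] -/
theorem Bf_eq_zero_of_not_mem (w : Sym2 V → ℝ) {U : Finset V} {x v : V} (hv : v ∉ U) (hvx : v ≠ x)
    (Ψ : Set V → ℝ) : Bf w U x v Ψ = 0 := by
  unfold Bf tf cf
  have h0 : ∀ ω : Set (Sym2 V), ind {ω : Set (Sym2 V) | (openGraph (ω ∩ edgesIn U)).Reachable x v} ω = 0 :=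
    fun ω => ind_of_not_mem fun h => hv (SandwichBHK.mem_of_reachable h (Ne.symm hvx))
  simp only [h0, mul_zero, Finset.sum_const_zero]; ring

/-- With `v = x` the covariance `B` vanishes (normalised weights): `1{x ∈ C_x} = 1`. [folklore] -/
theorem Bf_eq_zero_of_eq (w : Sym2 V → ℝ) (hm : ∑ ω, weight w ω = 1) (U : Finset V) (x : V)
    (Ψ : Set V → ℝ) : Bf w U x x Ψ = 0 := by
  unfold Bf tf cf
  have h1 : ∀ ω : Set (Sym2 V), ind {ω : Set (Sym2 V) | (openGraph (ω ∩ edgesIn U)).Reachable x x} ω = 1 :=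
    fun ω => ind_of_mem (SimpleGraph.Reachable.refl x)
  simp only [h1, mul_one, hm]; ring

/-- In a world not containing `x` (with `v ≠ x`) the covariance `B` vanishes: `C_x = {x}` cannot contain `v`.
[folklore] -/
theorem Bf_eq_zero_of_not_mem_owner (w : Sym2 V → ℝ) {U : Finset V} {x v : V} (hx : x ∉ U) (hvx : v ≠ x)
    (Ψ : Set V → ℝ) : Bf w U x v Ψ = 0 := by
  unfold Bf tf cf
  have h0 : ∀ ω : Set (Sym2 V), ind {ω : Set (Sym2 V) | (openGraph (ω ∩ edgesIn U)).Reachable x v} ω = 0 :=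
    fun ω => ind_of_not_mem fun h => hx (SandwichBHK.mem_of_reachable h.symm hvx)
  simp only [h0, mul_zero, Finset.sum_const_zero]; ring

/-- `Y(N) = 0` in `G[U]` when `v ∉ U` (and `v ≠ x`). [folklore] -/
theorem Yf_eq_zero_of_not_mem (w : Sym2 V → ℝ) {U : Finset V} {x v : V} (hv : v ∉ U) (hvx : v ≠ x)
    (Ψ : Set V → ℝ) (N : Set V) : Yf w U x v Ψ N = 0 :=
  Finset.sum_eq_zero fun ω _ => by
    rw [Bf_eq_zero_of_not_mem w (fun h' => hv (rest_subset U N ω h')) hvx]; ring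

/-- `Y(N) = 0` in `G[U]` when `x ∉ U` (and `v ≠ x`). [folklore] -/
theorem Yf_eq_zero_of_not_mem_owner (w : Sym2 V → ℝ) {U : Finset V} {x v : V} (hx : x ∉ U) (hvx : v ≠ x)
    (Ψ : Set V → ℝ) (N : Set V) : Yf w U x v Ψ N = 0 :=
  Finset.sum_eq_zero fun ω _ => by
    rw [Bf_eq_zero_of_not_mem_owner w (fun h' => hx (rest_subset U N ω h')) hvx]; ring

/-- `X(∅) = q·B` (the cluster of the empty source set is empty). [folklore] -/
theorem Xf_empty (w : Sym2 V → ℝ) (hm : ∑ ω, weight w ω = 1) (U : Finset V) (x o v : V) (Ψ : Set V → ℝ) :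
    Xf w U x o v Ψ ∅ = qf w U x o v * Bf w U x v Ψ := by
  unfold Xf
  have h : ∀ ω : Set (Sym2 V), ind (rD U x (∅ : Set V)) ω = 1 := fun ω => ind_of_mem fun _ h => h.elim
  simp only [rest_empty, h, mul_one]
  rw [← Finset.sum_mul, hm, one_mul]

/-- `Y(∅) = B`. [folklore] -/
theorem Yf_empty (w : Sym2 V → ℝ) (hm : ∑ ω, weight w ω = 1) (U : Finset V) (x v : V) (Ψ : Set V → ℝ) :
    Yf w U x v Ψ ∅ = Bf w U x v Ψ := by
  unfold Yf
  have h : ∀ ω : Set (Sym2 V), ind (rD U x (∅ : Set V)) ω = 1 := fun ω => ind_of_mem fun _ h => h.elim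
  simp only [rest_empty, h, mul_one]
  rw [← Finset.sum_mul, hm, one_mul]

end Summit.CriticalPhenomena.PercolationContinuityZ3.Theorems.CovTau
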